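import Literature.Probability.RandomPlanarGeometry.SAWPulledLargeForceExpansionZdWordTypesSixBlocks
import HarnessLib

/-!
# The fibre census of the cost-8 length-10 layer, cells part 3 of 8: masks 7–9 of 23

Topic `Literature/Probability/RandomPlanarGeometry` («ZD-FOUR-SLACK-TWO (B)», cells).  For each block mask `m` (the `sameLevel` table of a
group of height words of `FourSlackTwo.verts`), the seven kernel cells `cnt m k` (ROBUST form of `…ZdWordTypesSixBlocks`: nested raw-letter
fold, one `decide +kernel` per cell, ≈ 8 s each) and the census of the class for every `d` in falling-factorial form (`card_good_eq`).  The
masks are this file's tool notions (not notions in print); the tables `sameLevel_p_q_r` identify them with `FourSlackTwo.sameLevel (p,q,r)`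
on the nine even blocks for the listed height words.  No number is taken from print. [cite: MadrasSlade1993, §4.2, remark after Theorem 4.2.4 (p. 94)]

Provenance: lane «pcv-sawmu», a-p3 g18 (2026-08-25); expected values from the exact type enumerator `axistypes.py` (FINDING (22)).
-/

open Finset
open scoped BigOperators
open Literature.Probability.LatticeModels
open Literature.Probability.RandomPlanarGeometry.SAW

namespace Literature.Probability.RandomPlanarGeometry.SAW.Zd

namespace WordTypes

/-- The nine even blocks, as a list (for the mask tables of this part). [cite: MadrasSlade1993, Definition 1.2.4] -/
def nineBlocks3 : List (ℕ × ℕ) := [(0, 2), (1, 3), (2, 4), (3, 5), (4, 6), (0, 4), (1, 5), (2, 6), (0, 6)]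

/-- Mask 7: blocks [(0, 2), (0, 4), (0, 6), (1, 3), (2, 6), (3, 5), (4, 6)]. [cite: MadrasSlade1993, §4.2, remark after Theorem 4.2.4 (p. 94)] -/
def mask7 : ℕ → ℕ → Bool
  | 0, 2 => true
  | 0, 4 => true
  | 0, 6 => true
  | 1, 3 => true
  | 2, 6 => true
  | 3, 5 => true
  | 4, 6 => true
  | _, _ => false

/-- `sameLevel (1,5,9)` is mask 7 on the nine even blocks. [cite: MadrasSlade1993, §4.2, remark after Theorem 4.2.4 (p. 94)] -/
theorem sameLevel_1_5_9 : ∀ ij ∈ nineBlocks3, FourSlackTwo.sameLevel (1, 5, 9) ij.1 ij.2 = mask7 ij.1 ij.2 := by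
  decide +kernel

/-- Cell: mask 7, `k = 0` → 0. [cite: MadrasSlade1993, §4.2, remark after Theorem 4.2.4 (p. 94)] -/
theorem cnt_mask7_zero : cnt mask7 0 = 0 := by decide +kernel

/-- Cell: mask 7, `k = 1` → 2. [cite: MadrasSlade1993, §4.2, remark after Theorem 4.2.4 (p. 94)] -/
theorem cnt_mask7_one : cnt mask7 1 = 2 := by decide +kernel

/-- Cell: mask 7, `k = 2` → 532. [cite: MadrasSlade1993, §4.2, remark after Theorem 4.2.4 (p. 94)] -/
theorem cnt_mask7_two : cnt mask7 2 = 532 := by decide +kernel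

/-- Cell: mask 7, `k = 3` → 2920. [cite: MadrasSlade1993, §4.2, remark after Theorem 4.2.4 (p. 94)] -/
theorem cnt_mask7_three : cnt mask7 3 = 2920 := by decide +kernel

/-- Cell: mask 7, `k = 4` → 2944. [cite: MadrasSlade1993, §4.2, remark after Theorem 4.2.4 (p. 94)] -/
theorem cnt_mask7_four : cnt mask7 4 = 2944 := by decide +kernel

/-- Cell: mask 7, `k = 5` → 832. [cite: MadrasSlade1993, §4.2, remark after Theorem 4.2.4 (p. 94)] -/
theorem cnt_mask7_five : cnt mask7 5 = 832 := by decide +kernel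

/-- Cell: mask 7, `k = 6` → 64. [cite: MadrasSlade1993, §4.2, remark after Theorem 4.2.4 (p. 94)] -/
theorem cnt_mask7_six : cnt mask7 6 = 64 := by decide +kernel

/-- ★ Census of mask 7 for every `d` (1 height word(s) [(1, 5, 9)]): `n = [2, 532, 2920, 2944, 832, 64]` in `Σ_k n_k d^(k)`.
[cite: MadrasSlade1993, §4.2, remark after Theorem 4.2.4 (p. 94)] -/
theorem card_good_mask7 (d : ℕ) :
    (Finset.univ.filter fun u : Word 6 d => Good mask7 u).card = 2 * d.descFactorial 1 + 532 * d.descFactorial 2 + 2920 * d.descFactorial 3 + 2944 * d.descFactorial 4 + 832 * d.descFactorial 5 + 64 * d.descFactorial 6 := by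
  rw [card_good_eq]
  simp only [Finset.sum_range_succ, Finset.sum_range_zero, cnt_mask7_zero, cnt_mask7_one, cnt_mask7_two, cnt_mask7_three, cnt_mask7_four, cnt_mask7_five, cnt_mask7_six]
  ring

/-- Mask 8: blocks [(0, 2), (0, 4), (0, 6), (1, 5), (2, 4), (2, 6), (3, 5)]. [cite: MadrasSlade1993, §4.2, remark after Theorem 4.2.4 (p. 94)] -/
def mask8 : ℕ → ℕ → Bool
  | 0, 2 => true
  | 0, 4 => true
  | 0, 6 => true
  | 1, 5 => true
  | 2, 4 => true
  | 2, 6 => true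
  | 3, 5 => true
  | _, _ => false

/-- `sameLevel (1,4,8)` is mask 8 on the nine even blocks. [cite: MadrasSlade1993, §4.2, remark after Theorem 4.2.4 (p. 94)] -/
theorem sameLevel_1_4_8 : ∀ ij ∈ nineBlocks3, FourSlackTwo.sameLevel (1, 4, 8) ij.1 ij.2 = mask8 ij.1 ij.2 := by
  decide +kernel

/-- Cell: mask 8, `k = 0` → 0. [cite: MadrasSlade1993, §4.2, remark after Theorem 4.2.4 (p. 94)] -/
theorem cnt_mask8_zero : cnt mask8 0 = 0 := by decide +kernel

/-- Cell: mask 8, `k = 1` → 4. [cite: MadrasSlade1993, §4.2, remark after Theorem 4.2.4 (p. 94)] -/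
theorem cnt_mask8_one : cnt mask8 1 = 4 := by decide +kernel

/-- Cell: mask 8, `k = 2` → 656. [cite: MadrasSlade1993, §4.2, remark after Theorem 4.2.4 (p. 94)] -/
theorem cnt_mask8_two : cnt mask8 2 = 656 := by decide +kernel

/-- Cell: mask 8, `k = 3` → 3320. [cite: MadrasSlade1993, §4.2, remark after Theorem 4.2.4 (p. 94)] -/
theorem cnt_mask8_three : cnt mask8 3 = 3320 := by decide +kernel

/-- Cell: mask 8, `k = 4` → 3184. [cite: MadrasSlade1993, §4.2, remark after Theorem 4.2.4 (p. 94)] -/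
theorem cnt_mask8_four : cnt mask8 4 = 3184 := by decide +kernel

/-- Cell: mask 8, `k = 5` → 864. [cite: MadrasSlade1993, §4.2, remark after Theorem 4.2.4 (p. 94)] -/
theorem cnt_mask8_five : cnt mask8 5 = 864 := by decide +kernel

/-- Cell: mask 8, `k = 6` → 64. [cite: MadrasSlade1993, §4.2, remark after Theorem 4.2.4 (p. 94)] -/
theorem cnt_mask8_six : cnt mask8 6 = 64 := by decide +kernel

/-- ★ Census of mask 8 for every `d` (1 height word(s) [(1, 4, 8)]): `n = [4, 656, 3320, 3184, 864, 64]` in `Σ_k n_k d^(k)`.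
[cite: MadrasSlade1993, §4.2, remark after Theorem 4.2.4 (p. 94)] -/
theorem card_good_mask8 (d : ℕ) :
    (Finset.univ.filter fun u : Word 6 d => Good mask8 u).card = 4 * d.descFactorial 1 + 656 * d.descFactorial 2 + 3320 * d.descFactorial 3 + 3184 * d.descFactorial 4 + 864 * d.descFactorial 5 + 64 * d.descFactorial 6 := by
  rw [card_good_eq]
  simp only [Finset.sum_range_succ, Finset.sum_range_zero, cnt_mask8_zero, cnt_mask8_one, cnt_mask8_two, cnt_mask8_three, cnt_mask8_four, cnt_mask8_five, cnt_mask8_six]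
  ring

/-- Mask 9: blocks [(0, 2), (0, 4), (0, 6), (1, 5), (2, 4), (2, 6), (4, 6)]. [cite: MadrasSlade1993, §4.2, remark after Theorem 4.2.4 (p. 94)] -/
def mask9 : ℕ → ℕ → Bool
  | 0, 2 => true
  | 0, 4 => true
  | 0, 6 => true
  | 1, 5 => true
  | 2, 4 => true
  | 2, 6 => true
  | 4, 6 => true
  | _, _ => false

/-- `sameLevel (1,4,7)` is mask 9 on the nine even blocks. [cite: MadrasSlade1993, §4.2, remark after Theorem 4.2.4 (p. 94)] -/
theorem sameLevel_1_4_7 : ∀ ij ∈ nineBlocks3, FourSlackTwo.sameLevel (1, 4, 7) ij.1 ij.2 = mask9 ij.1 ij.2 := by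
  decide +kernel

/-- `sameLevel (3,6,9)` is mask 9 on the nine even blocks. [cite: MadrasSlade1993, §4.2, remark after Theorem 4.2.4 (p. 94)] -/
theorem sameLevel_3_6_9 : ∀ ij ∈ nineBlocks3, FourSlackTwo.sameLevel (3, 6, 9) ij.1 ij.2 = mask9 ij.1 ij.2 := by
  decide +kernel

/-- Cell: mask 9, `k = 0` → 0. [cite: MadrasSlade1993, §4.2, remark after Theorem 4.2.4 (p. 94)] -/
theorem cnt_mask9_zero : cnt mask9 0 = 0 := by decide +kernel

/-- Cell: mask 9, `k = 1` → 2. [cite: MadrasSlade1993, §4.2, remark after Theorem 4.2.4 (p. 94)] -/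
theorem cnt_mask9_one : cnt mask9 1 = 2 := by decide +kernel

/-- Cell: mask 9, `k = 2` → 572. [cite: MadrasSlade1993, §4.2, remark after Theorem 4.2.4 (p. 94)] -/
theorem cnt_mask9_two : cnt mask9 2 = 572 := by decide +kernel

/-- Cell: mask 9, `k = 3` → 3184. [cite: MadrasSlade1993, §4.2, remark after Theorem 4.2.4 (p. 94)] -/
theorem cnt_mask9_three : cnt mask9 3 = 3184 := by decide +kernel

/-- Cell: mask 9, `k = 4` → 3152. [cite: MadrasSlade1993, §4.2, remark after Theorem 4.2.4 (p. 94)] -/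
theorem cnt_mask9_four : cnt mask9 4 = 3152 := by decide +kernel

/-- Cell: mask 9, `k = 5` → 864. [cite: MadrasSlade1993, §4.2, remark after Theorem 4.2.4 (p. 94)] -/
theorem cnt_mask9_five : cnt mask9 5 = 864 := by decide +kernel

/-- Cell: mask 9, `k = 6` → 64. [cite: MadrasSlade1993, §4.2, remark after Theorem 4.2.4 (p. 94)] -/
theorem cnt_mask9_six : cnt mask9 6 = 64 := by decide +kernel

/-- ★ Census of mask 9 for every `d` (2 height word(s) [(1, 4, 7), (3, 6, 9)]): `n = [2, 572, 3184, 3152, 864, 64]` in `Σ_k n_k d^(k)`.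
[cite: MadrasSlade1993, §4.2, remark after Theorem 4.2.4 (p. 94)] -/
theorem card_good_mask9 (d : ℕ) :
    (Finset.univ.filter fun u : Word 6 d => Good mask9 u).card = 2 * d.descFactorial 1 + 572 * d.descFactorial 2 + 3184 * d.descFactorial 3 + 3152 * d.descFactorial 4 + 864 * d.descFactorial 5 + 64 * d.descFactorial 6 := by
  rw [card_good_eq]
  simp only [Finset.sum_range_succ, Finset.sum_range_zero, cnt_mask9_zero, cnt_mask9_one, cnt_mask9_two, cnt_mask9_three, cnt_mask9_four, cnt_mask9_five, cnt_mask9_six]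
  ring

end WordTypes

end Literature.Probability.RandomPlanarGeometry.SAW.Zd
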